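import Mathlib
import HarnessLib
import Summits.RiemannHypothesis.RiemannHypothesis.Theses.WeilParity
import Literature.NumberTheory.LFunctions.WeilGroundEnergyParitySplit
import Literature.NumberTheory.LFunctions.WeilOddGroundState
import Literature.NumberTheory.LFunctions.WeilSmallSupportPositivity
import Literature.NumberTheory.LFunctions.WeilWindowSuzukiContinuityProofs
import Literature.NumberTheory.LFunctions.WeilGroundEnergyProofs
import Literature.NumberTheory.LFunctions.WeilResolventVector
import Literature.NumberTheory.LFunctions.AdversarialWeilPositivity
import Summits.RiemannHypothesis.RiemannHypothesis.Theorems.WeilParityEvenWinsArch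
import Summits.RiemannHypothesis.RiemannHypothesis.Theorems.WeilGroundStateGroundStateSimpleEvenArch

/-!
# Disproof of `EvenWinsArch` (crux stmt-RiemannHypothesis-15433, route WeilParity) — findings

Crux: `∀ a, 0 < a → a ≤ (log 2)/2 → ∀ o` odd normalised Weil test on `[-a,a]` `→ ∀ δ > 0 → ∃ e` even
normalised Weil test on `[-a,a]` with `Re Q(e) ≤ Re Q(o) + δ` (`Q = weilQuadratic`), i.e. the ORDER of
the sector bottoms `ε_ev(a) ≤ ε_od(a)` on every prime-free window.

Standing disprover: refuter-cdisprove-stmt-RiemannHypothesis-15433-0, cycle 1 (2026-08-17).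

## 0. VERDICT: NOT REFUTABLE — the crux is a THEOREM
* `evenWinsArch_irrefutable : ¬ ¬ EvenWinsArch` — from the LANDED proof
  `Theorems.WeilParity.evenWinsArch_proof` (p151491, item closed `proved` 2026-08-17T09:28:50Z; parity
  ladder by dilation transport). Sanity (this seat): type is the route decl verbatim (`rfl` probe), axioms
  = {propext, Classical.choice, Quot.sound}. A second, independent proof is in the tree via the sibling
  crux's `Theorems.stub_archimedeanWindows` (p145580: `WeilWindowSimpleEven a` on every `a ≤ (log 2)/2`),
  re-derived below as the STRICT order `weilEvenGroundEnergy_lt_odd_arch`.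
* Consequently every attack below is a LOAD-BEARING / SHARPNESS analysis, not a kill attempt.

## (a) Load-bearing analysis (one hypothesis dropped at a time)
* `∫ ‖o‖² = 1` (normalisation of the odd competitor): LOAD-BEARING —
  `evenWinsArch_false_without_norm` (witness `o = 0`: the conclusion would force `ε_ev(a) ≤ δ` for all
  `δ`, against coercivity `ε(a) ≥ 1` on small windows, Bombieri 2000 Thm 12). (Same finding filed by
  refuter-rattack-…-15433-0 as p151136, `Theorems/EvenWinsArch/Negative/LoadBearing.lean`, pending.)
* `tsupport o ⊆ [-a, a]` (the odd competitor lives on the SAME window): LOAD-BEARING —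
  `evenWinsArch_false_without_support` (a fixed odd normalised test `o₀` on `[-1,1]` has a fixed energy
  `q₀`; coercivity gives windows with `ε(a) ≥ q₀ + 1`, so no even window test comes within `1/2`).
  LANDING as `Theorems/EvenWinsArch/Negative/WithoutSupport.lean`.
* `0 < a`: DECORATION — `evenWinsArchWithoutPos_holds` (for `a ≤ 0` a window test vanishes identically,
  `IsWeilTest.eq_zero_of_tsupport_subset`, so `∫ ‖o‖² = 0 ≠ 1`: the hypotheses are unsatisfiable).
* `a ≤ (log 2)/2`: dropping it is VERBATIM the route target `EvenSectorWins` (`withoutUpper_iff_target`,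
  `Iff.rfl`) — RH-strength if crux #2 `OffLineParityDetection` holds; not attackable here.
* oddness of `o`: NOT load-bearing GIVEN the crux — `evenWinsArchWithoutOdd_holds`: every normalised
  window test (any parity or none) is matched by an even one, because `ε = min(ε_ev, ε_od) = ε_ev`.
* `IsWeilTest o`: only JUNK bites (for non-test `o` the Bochner integrals inside `weilQuadratic` may take
  junk values); rough `L²` window functions in the form domain still satisfy the conclusion by density.
  Not pursued (no information for provers).
* `0 < δ` (the slack): REMOVABLE — `evenWinsArchSharp_holds`: with `δ = 0` and STRICT inequality the
  statement still holds (`ε_ev(a) < ε_od(a) ≤ Re Q(o)` and `csInf` approximation below `Re Q(o)`).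

## (b) Tightness
* The range endpoint `(log 2)/2` is tight for the METHOD only (first prime power enters `W(g ⋆ g̃)` at
  `a > (log 2)/2`), not for the statement: the order is certified numerically up to `(log 3)/2`
  (sibling item OnePrimeWindowSimpleEven, cells with margin ≈ 10×) and conjectured for all `a`
  (= EvenSectorWins). No tightness lemma is available or expected.
* The gap is NOT uniform in ratio: heuristically `ε_±(a) = log(1/a) + μ_± + o(1)` as `a → 0⁺` (scale
  covariance of the archimedean symbol `Re ψ(1/4 + iξ/2) ~ log ξ`), so `ε_od/ε_ev → 1` while
  `ε_od − ε_ev → μ_od − μ_ev > 0`; numerics (rattack scan): ratio 1.38 at `a = 0.005` rising to 55 at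
  `(log 2)/2`. The strengthening "`c · ε_ev(a) ≤ ε_od(a)` for some `c > 1` and all `a ≤ (log 2)/2`" is
  therefore expected FALSE, but a proof needs two-sided `log(1/a) + O(1)` asymptotics of BOTH sector
  bottoms, of which the tree has only the even/global upper side
  (`Theorems/WeilGroundStateGroundStateSimpleEvenArchEvenUpper.lean`) and Bombieri's non-quantitative
  coercive lower side — recorded as an open remark, not a sorried theorem (outside the anti-leakage remit).

## (c) Natural strengthenings
* `δ = 0`, strict: TRUE (`evenWinsArchSharp_holds`).
* competitor of any parity: TRUE (`evenWinsArchWithoutOdd_holds`).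
* window `a ≤ 0` included: TRUE vacuously (`evenWinsArchWithoutPos_holds`).
* all windows: = EvenSectorWins (open, RH-strength). Windows `≤ (log 3)/2`: = OnePrimeWindowSimpleEven's
  order consequence (open, certifiable).

## -- Targets
payload.stuck_stubs = [] and the line `birth`'s stubs are all LANDED (p147506 … p151062); nothing to attack.

## -- Line registered (`birth`, parity ladder)
Joint sufficiency is kernel-checked in the landed closing file (`evenOrder` + `evenWinsAt_of_le`); the
three ladder stubs are theorems (p151062). No gap to smuggle.
-/

set_option linter.dupNamespace false

noncomputable section

namespace Summit.RiemannHypothesis.RiemannHypothesis.Cruxes.EvenWinsArch.Disproof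

open Set MeasureTheory
open Literature.NumberTheory.LFunctions
open Summit.RiemannHypothesis.RiemannHypothesis.Theses.WeilParity

/-! ## 0. The crux is a theorem -/

/-- **No disproof exists (in a consistent tree):** `EvenWinsArch` is proved
(`Theorems.WeilParity.evenWinsArch_proof`, p151491; axioms propext/Classical.choice/Quot.sound). -/
theorem evenWinsArch_irrefutable : ¬ ¬ EvenWinsArch :=
  fun h ↦ h Summit.RiemannHypothesis.RiemannHypothesis.Theorems.WeilParity.evenWinsArch_proof

/-- `0 < (log 2)/2`. -/
theorem log_two_half_pos : 0 < Real.log 2 / 2 := by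
  have := Real.log_two_gt_d9
  linarith

/-- **Strict order on every prime-free window** (second, independent proof of the crux's content):
`ε_ev(a) < ε_od(a)` for `0 < a ≤ (log 2)/2`, from the sibling crux's landed
`Theorems.stub_archimedeanWindows` (`WeilWindowSimpleEven a`: odd branch gives `ε(a) + δ₀ ≤ ε_od(a)`)
and `ε = min(ε_ev, ε_od)`. -/
theorem weilEvenGroundEnergy_lt_odd_arch {a : ℝ} (ha : 0 < a) (hle : a ≤ Real.log 2 / 2) :
    weilEvenGroundEnergy a < weilOddGroundEnergy a := by
  obtain ⟨φ, δ₀, hδ₀, hgap⟩ :=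
    Summit.RiemannHypothesis.RiemannHypothesis.Theorems.stub_archimedeanWindows a ha hle
  have hodd : weilGroundEnergy a + δ₀ ≤ weilOddGroundEnergy a :=
    le_weilOddGroundEnergy_of_forall ha fun g hg hs hodd hn ↦ hgap g hg hs hn (Or.inl hodd)
  have hmin := weilGroundEnergy_eq_min_even_odd a
  rcases le_total (weilEvenGroundEnergy a) (weilOddGroundEnergy a) with h | h
  · rw [min_eq_left h] at hmin
    linarith
  · rw [min_eq_right h] at hmin
    linarith

/-- `csInf`-approximation in the even sector: any level strictly above `ε_ev(a)` (`a > 0`) is undercut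
by an even normalised window test. -/
theorem exists_even_lt {a b : ℝ} (ha : 0 < a) (hb : weilEvenGroundEnergy a < b) :
    ∃ e : ℝ → ℂ, IsWeilTest e ∧ tsupport e ⊆ Set.Icc (-a) a ∧ (∀ t, e (-t) = e t) ∧
      ∫ t, ‖e t‖ ^ 2 = (1 : ℝ) ∧ (weilQuadratic e).re < b := by
  have hne := weilWindowSphereValues_even_nonempty ha
  have hlt : sInf (weilWindowSphereValues (fun g ↦ ∀ t, g (-t) = g t) a) < b := by
    rwa [← weilEvenGroundEnergy_eq_sInf]
  obtain ⟨x, hx, hxlt⟩ := exists_lt_of_csInf_lt hne hlt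
  obtain ⟨e, he, hes, hev, hen, rfl⟩ := hx
  exact ⟨e, he, hes, hev, hen, hxlt⟩

/-! ## (a) Load-bearing analysis -/

/-- The crux with the NORMALISATION `∫ ‖o‖² = 1` of the odd competitor dropped. -/
def EvenWinsArchWithoutNorm : Prop :=
  ∀ a : ℝ, 0 < a → a ≤ Real.log 2 / 2 → ∀ o : ℝ → ℂ, IsWeilTest o → tsupport o ⊆ Set.Icc (-a) a →
    (∀ t, o (-t) = -o t) → ∀ δ : ℝ, 0 < δ → ∃ e : ℝ → ℂ, IsWeilTest e ∧
      tsupport e ⊆ Set.Icc (-a) a ∧ (∀ t, e (-t) = e t) ∧ ∫ t, ‖e t‖ ^ 2 = (1 : ℝ) ∧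
      (weilQuadratic e).re ≤ (weilQuadratic o).re + δ

/-- **The normalisation of `o` is load-bearing.** Witness `o = 0` (odd, a test, supported anywhere,
`Q(0) = 0`): the conclusion would give even normalised tests of energy `≤ δ` on arbitrarily small
windows, contradicting coercivity `Re Q(e) ≥ 1 · ‖e‖²` for `tsupport e ⊆ [-a, a]`, `a ≤ a₀`
(`weilQuadratic_coercive`, Bombieri 2000 Thm 12). -/
theorem evenWinsArch_false_without_norm : ¬ EvenWinsArchWithoutNorm := by
  intro h
  obtain ⟨a₀, ha₀, hco⟩ := weilQuadratic_coercive 1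
  have ha : 0 < min a₀ (Real.log 2 / 2) := lt_min ha₀ log_two_half_pos
  obtain ⟨e, he, hes, -, hen, hle⟩ := h (min a₀ (Real.log 2 / 2)) ha (min_le_right _ _) 0
    isWeilTest_zero (by simp [tsupport_zero]) (by simp) (1 / 2) (by norm_num)
  have h1 := hco _ ha (min_le_left _ _) e he hes
  rw [hen, mul_one] at h1
  rw [weilQuadratic_zero, Complex.zero_re] at hle
  linarith

/-- The crux with the WINDOW CONSTRAINT `tsupport o ⊆ [-a, a]` on the odd competitor dropped (the even
partner must still live on `[-a, a]`). -/
def EvenWinsArchWithoutSupport : Prop :=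
  ∀ a : ℝ, 0 < a → a ≤ Real.log 2 / 2 → ∀ o : ℝ → ℂ, IsWeilTest o → (∀ t, o (-t) = -o t) →
    ∫ t, ‖o t‖ ^ 2 = (1 : ℝ) → ∀ δ : ℝ, 0 < δ → ∃ e : ℝ → ℂ, IsWeilTest e ∧
      tsupport e ⊆ Set.Icc (-a) a ∧ (∀ t, e (-t) = e t) ∧ ∫ t, ‖e t‖ ^ 2 = (1 : ℝ) ∧
      (weilQuadratic e).re ≤ (weilQuadratic o).re + δ

/-- **The window constraint on `o` is load-bearing** (the statement is genuinely window-RELATIVE):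
fix one odd normalised test `o₀` on `[-1, 1]` (`exists_isWeilTest_odd_sphere`) with energy
`q₀ = Re Q(o₀)`; by coercivity there is `a₀` with `Re Q(e) ≥ q₀ + 1` for every normalised test on
`[-a, a]`, `a ≤ a₀`; at `a = min a₀ ((log 2)/2)` no even window test comes within `1/2` of `q₀`. -/
theorem evenWinsArch_false_without_support : ¬ EvenWinsArchWithoutSupport := by
  intro h
  obtain ⟨o, ho, -, hodd, hon⟩ := exists_isWeilTest_odd_sphere one_pos
  obtain ⟨a₀, ha₀, hco⟩ := weilQuadratic_coercive ((weilQuadratic o).re + 1)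
  have ha : 0 < min a₀ (Real.log 2 / 2) := lt_min ha₀ log_two_half_pos
  obtain ⟨e, he, hes, -, hen, hle⟩ :=
    h (min a₀ (Real.log 2 / 2)) ha (min_le_right _ _) o ho hodd hon (1 / 2) (by norm_num)
  have h1 := hco _ ha (min_le_left _ _) e he hes
  rw [hen, mul_one] at h1
  linarith

/-- The crux with the POSITIVITY `0 < a` of the window dropped. -/
def EvenWinsArchWithoutPos : Prop :=
  ∀ a : ℝ, a ≤ Real.log 2 / 2 → ∀ o : ℝ → ℂ, IsWeilTest o → tsupport o ⊆ Set.Icc (-a) a →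
    (∀ t, o (-t) = -o t) → ∫ t, ‖o t‖ ^ 2 = (1 : ℝ) → ∀ δ : ℝ, 0 < δ → ∃ e : ℝ → ℂ, IsWeilTest e ∧
      tsupport e ⊆ Set.Icc (-a) a ∧ (∀ t, e (-t) = e t) ∧ ∫ t, ‖e t‖ ^ 2 = (1 : ℝ) ∧
      (weilQuadratic e).re ≤ (weilQuadratic o).re + δ

/-- **`0 < a` is decoration:** for `a ≤ 0` the hypotheses are unsatisfiable (a test function with
`tsupport ⊆ [-a, a]`, `a ≤ 0`, is identically `0`, so `∫ ‖o‖² = 0 ≠ 1`), and for `a > 0` the crux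
applies. Information for planners: the hypothesis may be dropped from the item without loss. -/
theorem evenWinsArchWithoutPos_holds : EvenWinsArchWithoutPos := by
  intro a hle o ho hos hodd hon δ hδ
  rcases le_or_gt a 0 with ha | ha
  · exfalso
    have h0 : o = 0 := ho.eq_zero_of_tsupport_subset hos ha
    simp [h0] at hon
  · exact Summit.RiemannHypothesis.RiemannHypothesis.Theorems.WeilParity.evenWinsArch_proof
      a ha hle o ho hos hodd hon δ hδ

/-- The crux with the UPPER BOUND `a ≤ (log 2)/2` dropped. -/
def EvenWinsArchWithoutUpper : Prop :=
  ∀ a : ℝ, 0 < a → ∀ o : ℝ → ℂ, IsWeilTest o → tsupport o ⊆ Set.Icc (-a) a →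
    (∀ t, o (-t) = -o t) → ∫ t, ‖o t‖ ^ 2 = (1 : ℝ) → ∀ δ : ℝ, 0 < δ → ∃ e : ℝ → ℂ, IsWeilTest e ∧
      tsupport e ⊆ Set.Icc (-a) a ∧ (∀ t, e (-t) = e t) ∧ ∫ t, ‖e t‖ ^ 2 = (1 : ℝ) ∧
      (weilQuadratic e).re ≤ (weilQuadratic o).re + δ

/-- **Dropping `a ≤ (log 2)/2` gives VERBATIM the route target `EvenSectorWins`** (rank 0; RH-strength
modulo crux #2 `OffLineParityDetection`): the upper bound is what makes the crux RH-free. -/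
theorem withoutUpper_iff_target : EvenWinsArchWithoutUpper ↔ EvenSectorWins := Iff.rfl

/-- The crux with the ODDNESS of the competitor `o` dropped (any normalised window test). -/
def EvenWinsArchWithoutOdd : Prop :=
  ∀ a : ℝ, 0 < a → a ≤ Real.log 2 / 2 → ∀ o : ℝ → ℂ, IsWeilTest o → tsupport o ⊆ Set.Icc (-a) a →
    ∫ t, ‖o t‖ ^ 2 = (1 : ℝ) → ∀ δ : ℝ, 0 < δ → ∃ e : ℝ → ℂ, IsWeilTest e ∧
      tsupport e ⊆ Set.Icc (-a) a ∧ (∀ t, e (-t) = e t) ∧ ∫ t, ‖e t‖ ^ 2 = (1 : ℝ) ∧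
      (weilQuadratic e).re ≤ (weilQuadratic o).re + δ

/-- **Oddness of `o` is not load-bearing, given the crux:** on a prime-free window the even bottom is
the GLOBAL bottom (`ε(a) = min(ε_ev, ε_od) = ε_ev(a)` by the order `evenOrder`), so every normalised
window test of any parity is matched by an even one. (The mutation is a consequence of the crux, not a
cheaper statement: it is equivalent to `ε_ev = ε` on the range.) -/
theorem evenWinsArchWithoutOdd_holds : EvenWinsArchWithoutOdd := by
  intro a ha hle o ho hos hon δ hδ
  have hord : weilEvenGroundEnergy a ≤ weilOddGroundEnergy a :=
    Summit.RiemannHypothesis.RiemannHypothesis.Theorems.WeilParity.evenOrder ha hle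
  have hmin := weilGroundEnergy_eq_min_even_odd a
  rw [min_eq_left hord] at hmin
  have hle' : weilEvenGroundEnergy a ≤ (weilQuadratic o).re := by
    rw [← hmin]
    exact weilGroundEnergy_le_re_weilQuadratic ho hos hon
  obtain ⟨e, he, hes, hev, hen, hlt⟩ := exists_even_lt ha (show weilEvenGroundEnergy a <
    (weilQuadratic o).re + δ by linarith)
  exact ⟨e, he, hes, hev, hen, hlt.le⟩

/-! ## (c) The sharp form: the slack `δ` is removable -/

/-- The crux with `δ = 0` and STRICT inequality. -/
def EvenWinsArchSharp : Prop :=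
  ∀ a : ℝ, 0 < a → a ≤ Real.log 2 / 2 → ∀ o : ℝ → ℂ, IsWeilTest o → tsupport o ⊆ Set.Icc (-a) a →
    (∀ t, o (-t) = -o t) → ∫ t, ‖o t‖ ^ 2 = (1 : ℝ) → ∃ e : ℝ → ℂ, IsWeilTest e ∧
      tsupport e ⊆ Set.Icc (-a) a ∧ (∀ t, e (-t) = e t) ∧ ∫ t, ‖e t‖ ^ 2 = (1 : ℝ) ∧
      (weilQuadratic e).re < (weilQuadratic o).re

/-- **The slack `δ > 0` is removable:** every odd normalised window test is STRICTLY undercut by an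
even one (`ε_ev(a) < ε_od(a) ≤ Re Q(o)`, strict order from `stub_archimedeanWindows`, then
`csInf`-approximation below the level `Re Q(o)`). The natural strengthening is TRUE, not refutable. -/
theorem evenWinsArchSharp_holds : EvenWinsArchSharp := by
  intro a ha hle o ho hos hodd hon
  have hlt : weilEvenGroundEnergy a < (weilQuadratic o).re :=
    (weilEvenGroundEnergy_lt_odd_arch ha hle).trans_le (weilOddGroundEnergy_le ho hos hodd hon)
  exact exists_even_lt ha hlt

/-- The sharp form implies the crux (so it is a genuine strengthening). -/
theorem evenWinsArch_of_sharp (h : EvenWinsArchSharp) : EvenWinsArch := by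
  intro a ha hle o ho hos hodd hon δ hδ
  obtain ⟨e, he, hes, hev, hen, hlt⟩ := h a ha hle o ho hos hodd hon
  exact ⟨e, he, hes, hev, hen, by linarith⟩

end Summit.RiemannHypothesis.RiemannHypothesis.Cruxes.EvenWinsArch.Disproof

end
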